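import Summits.NavierStokesRegularity.NavierStokesRegularity.Theorems.StrainDoorsPoissonTrace
import HarnessLib

/-!
# StrainDoorsAlgebra — door family S37 «StrainDoors» (nsreg-p1 ROUND-35): the pointwise algebra at a strain argmax

S-door lane (ns-sfl-p1 g5; LEAD ns-s30-p1 g3; plan of record nsreg-p1 g31 2026-08-28T17:58:24Z; texts pending — TOOL for
plate E1_S «StrainGrowth»; `--supports stmt-NavierStokesRegularity-0056 --as helper`). The gradient equation
`∂ₜA + (u·∇)A + A² = −∇²p + νΔA` (`A = ∇u`) charges, at a maximiser `(x̄, ē)` of the Rayleigh quotient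
`⟪∇u(x)e, e⟫`, the quadratic term `−⟪A²ē, ē⟫`. Pointwise linear algebra in `ℝ³` (no PDE):

* `inner_comp_self_apply_eq` — polarisation: `⟪A(Ae), e⟫ = ¼‖(A + A†)e‖² − ¼‖(A − A†)e‖²` (`= |Se|² − |Ωe|²`);
* `norm_sub_adjoint_apply_sq` — for `A = Dv(x)`: `‖(A − A†)e‖² = ‖curl v‖²‖e‖² − ⟪curl v, e⟫²` (`(A − A†)e = ω × e`,
  Lagrange's identity, in coordinates);
* `sq_inner_le_norm_add_adjoint_apply_sq` — `⟪Ae, e⟫² ≤ ¼‖e‖²‖(A + A†)e‖²` (Cauchy–Schwarz, `⟪(A + A†)e, e⟫ = 2⟪Ae,e⟫`);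
* `neg_inner_fderiv_fderiv_le` — hence for a unit vector `e`:
  `−⟪Dv(Dv e), e⟫ ≤ −⟪Dv e, e⟫² + ¼(‖curl v‖² − ⟪curl v, e⟫²)` — the shape + alignment part of the feeding term
  `H` in `∂ₜΛ ≤ −Λ² + H` (nsreg-p1 ROUND-35 plan).

WHAT THIS IS NOT: algebra serving a regularity CRITERION (door family S37); item 0056 `NoTypeII` and NS regularity are
NOT proved; nothing here is a route or a summit statement.
-/

-- the summit's problem namespace repeats the summit name (tree layout)
set_option linter.dupNamespace false

noncomputable section

open Set Function InnerProductSpace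
open scoped RealInnerProductSpace
open Literature.Analysis Literature.Analysis.FluidPDE VectorCalculus

namespace Summit.NavierStokesRegularity.NavierStokesRegularity.Theorems.ArgmaxDoors

/-- Polarisation: `⟪A(Ae), e⟫ = ¼‖(A + A†)e‖² − ¼‖(A − A†)e‖²` (any finite-dimensional real inner product space). -/
theorem inner_comp_self_apply_eq {E : Type*} [NormedAddCommGroup E] [InnerProductSpace ℝ E] [CompleteSpace E]
    (A : E →L[ℝ] E) (e : E) :
    ⟪A (A e), e⟫ = ‖(A + ContinuousLinearMap.adjoint A) e‖ ^ 2 / 4 -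
      ‖(A - ContinuousLinearMap.adjoint A) e‖ ^ 2 / 4 := by
  have h1 : ⟪A (A e), e⟫ = ⟪A e, ContinuousLinearMap.adjoint A e⟫ := by
    rw [ContinuousLinearMap.adjoint_inner_right]
  rw [h1, add_apply, sub_apply, ← real_inner_self_eq_norm_sq, ← real_inner_self_eq_norm_sq,
    real_inner_add_add_self, real_inner_sub_sub_self]
  ring

/-- Coordinates of a vector after a linear map, standard frame of `ℝ³`: `(B w)ₖ = Σⱼ wⱼ (B eⱼ)ₖ`. -/
theorem apply_coord_eq_sum (B : EuclideanSpace ℝ (Fin 3) →L[ℝ] EuclideanSpace ℝ (Fin 3))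
    (w : EuclideanSpace ℝ (Fin 3)) (k : Fin 3) :
    B w k = ∑ j, w j * B (EuclideanSpace.single j 1) k := by
  conv_lhs => rw [← (EuclideanSpace.basisFun (Fin 3) ℝ).sum_repr w]
  simp [map_sum, map_smul, EuclideanSpace.basisFun_apply, WithLp.ofLp_sum, Finset.sum_apply]

/-- Lagrange's identity for the spin: for `A = Dv(x)` in `ℝ³`, `‖(A − A†)e‖² = ‖curl v(x)‖²‖e‖² − ⟪curl v(x), e⟫²`
(`(A − A†)e = ω × e`). -/
theorem norm_sub_adjoint_apply_sq (v : EuclideanSpace ℝ (Fin 3) → EuclideanSpace ℝ (Fin 3))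
    (x e : EuclideanSpace ℝ (Fin 3)) :
    ‖(fderiv ℝ v x - ContinuousLinearMap.adjoint (fderiv ℝ v x)) e‖ ^ 2 =
      ‖curl v x‖ ^ 2 * ‖e‖ ^ 2 - ⟪curl v x, e⟫ ^ 2 := by
  have hB : ∀ k : Fin 3, (fderiv ℝ v x - ContinuousLinearMap.adjoint (fderiv ℝ v x)) e k =
      ∑ j, e j * (fderiv ℝ v x (EuclideanSpace.single j 1) k - fderiv ℝ v x (EuclideanSpace.single k 1) j) := by
    intro k
    rw [apply_coord_eq_sum]
    refine Finset.sum_congr rfl fun j _ => ?_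
    rw [sub_apply, PiLp.sub_apply, adjoint_single_apply]
  have hcurl : ∀ i : Fin 3, curl v x i =
      ![fderiv ℝ v x (EuclideanSpace.single 1 1) 2 - fderiv ℝ v x (EuclideanSpace.single 2 1) 1,
        fderiv ℝ v x (EuclideanSpace.single 2 1) 0 - fderiv ℝ v x (EuclideanSpace.single 0 1) 2,
        fderiv ℝ v x (EuclideanSpace.single 0 1) 1 - fderiv ℝ v x (EuclideanSpace.single 1 1) 0] i := by
    intro i
    rfl
  rw [EuclideanSpace.norm_sq_eq, EuclideanSpace.norm_sq_eq, EuclideanSpace.norm_sq_eq, PiLp.inner_apply]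
  simp only [Fin.sum_univ_three, Real.norm_eq_abs, sq_abs, hB, hcurl, RCLike.inner_apply, conj_trivial]
  simp only [Matrix.cons_val_zero, Matrix.cons_val_one, Matrix.cons_val]
  ring

/-- Cauchy–Schwarz for the Rayleigh quotient: `⟪Ae, e⟫² ≤ ¼‖e‖²‖(A + A†)e‖²` (`⟪(A + A†)e, e⟫ = 2⟪Ae, e⟫`). -/
theorem sq_inner_le_norm_add_adjoint_apply_sq {E : Type*} [NormedAddCommGroup E] [InnerProductSpace ℝ E]
    [CompleteSpace E] (A : E →L[ℝ] E) (e : E) :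
    ⟪A e, e⟫ ^ 2 ≤ ‖e‖ ^ 2 * ‖(A + ContinuousLinearMap.adjoint A) e‖ ^ 2 / 4 := by
  have h2 : ⟪(A + ContinuousLinearMap.adjoint A) e, e⟫ = 2 * ⟪A e, e⟫ := by
    rw [add_apply, inner_add_left, ContinuousLinearMap.adjoint_inner_left, real_inner_comm]
    ring
  have hcs := abs_real_inner_le_norm ((A + ContinuousLinearMap.adjoint A) e) e
  rw [h2] at hcs
  have h0 : 0 ≤ ‖(A + ContinuousLinearMap.adjoint A) e‖ * ‖e‖ := by positivity
  have h3 : (2 * ⟪A e, e⟫) ^ 2 ≤ (‖(A + ContinuousLinearMap.adjoint A) e‖ * ‖e‖) ^ 2 := by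
    rw [← sq_abs (2 * ⟪A e, e⟫)]
    exact pow_le_pow_left₀ (abs_nonneg _) hcs 2
  nlinarith [h3]

/-- **The quadratic term at a strain maximiser** (tool for plate E1_S «StrainGrowth»): for `A = Dv(x)` in `ℝ³` and
a unit vector `e`, `−⟪A(Ae), e⟫ ≤ −⟪Ae, e⟫² + ¼(‖curl v(x)‖² − ⟪curl v(x), e⟫²)`
(`−⟪A²e,e⟫ = −|Se|² + |Ωe|²`, `|Se|² ≥ ⟪Se,e⟫² = ⟪Ae,e⟫²`, `|Ωe|² = ¼|ω × e|²`). -/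
theorem neg_inner_fderiv_fderiv_le (v : EuclideanSpace ℝ (Fin 3) → EuclideanSpace ℝ (Fin 3))
    (x e : EuclideanSpace ℝ (Fin 3)) (he : ‖e‖ = 1) :
    -⟪fderiv ℝ v x (fderiv ℝ v x e), e⟫ ≤
      -⟪fderiv ℝ v x e, e⟫ ^ 2 + (‖curl v x‖ ^ 2 - ⟪curl v x, e⟫ ^ 2) / 4 := by
  rw [inner_comp_self_apply_eq, norm_sub_adjoint_apply_sq, he]
  have h := sq_inner_le_norm_add_adjoint_apply_sq (fderiv ℝ v x) e
  rw [he] at h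
  nlinarith [h]

end Summit.NavierStokesRegularity.NavierStokesRegularity.Theorems.ArgmaxDoors

end
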